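import Summits.QuantumFields.BalabanUV.Beta.GAN24.EffectiveFormDecayBackground
import Summits.QuantumFields.BalabanUV.Beta.GAN24.CouplingLetterStencil

/-!
# `BalabanUV.Beta.GAN24.CouplingEffectiveFormDecay` — binder row G-an2-4 ∕ (CONV-C), routes R6 × R7, PART 248: PART 129 FOR COUPLING LETTERS — the perturbed block covariance
# `c_k(t) = L^{dk}Q_k(Δ_a^{(k)} + t·A^{(k)})⁻¹Q_kᴴ` of a COUPLING letter `A = P(V₁) + P(V₂)ᴴ + diag W` (the class of the exact abelian covariant Laplacian `Δ^U − Δ^1`, NE2's `covPert_eq`) has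
# a decaying inverse and the effective form `Σ_k(t) = c_k(t)⁻¹ − a″1` has the two-level decay rate, UNIFORMLY IN LEVEL, VOLUME AND THE COUPLING DISC `‖t‖ ≤ T` (`T` from
# `(d, a, α, β, α′, β′)`): PART 129's two theorems VERBATIM with PART 236's `perturbationLaws_couplingLetter` (`κ₀ = 2d(α+β)Cst + α′Cst`, `C₂ = C2model + C2adj + Cst²β′`) and
# `hPc_couplingLetter` (`κ_c = dαG₂ + d·e^{|κ|}(αG₂ + β(γ_D − J)⁻¹) + α′(γ_D − J)⁻¹`) in place of the first-order ones — the VALUE sector (U ≠ 1 itself, no derivative) for coupling letters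
# (unit b2b-balaban-gan24-p3, gen 65; v1; generator `HOME/b2b-balaban-gan24-p3/gen65/records/gen/gen248.py` over the tree text of PART 129)

NOT IN PRINT; OUR PROOF ([folklore] bookkeeping BY NAME over PART 129 (`entryDecay_inv_distK_re`, `hdecB_pert_of_wCoercive`, `coercive_mono`, `coercive_pertCov_QB`, `Cpert_le_of_norm_le`), PART 236,
PART 118 (`effForm_perturbed_balaban`), PART 124 (`conjDefect_calDalev_rho`, `max_JA_lt_gamD`), `decayStations_of_rate`; [King1986] Lemma 4.5 (4.38) p. 674 LOCATES the shape; nothing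
printed is a hypothesis).
HONEST FRAMING (cell contract, verbatim): «discharging `BetaPertH` makes Bałaban's UV stability UNCONDITIONAL — a real constructive-QFT result; it is NOT the
continuum limit and NOT the Clay problem.»  HONEST DEPENDENCY (verbatim): «continuum YM on T⁴ ⇐ BetaPertH ∧ nine spine estimates (0/9 proved); BetaPertH ⇐
(D1) ∧ (D4) ∧ CAP+tail; G-an2-4 gates asym, D1 and NE2/3/4.»

WHAT THIS FILE PROVES (0 sorry, 0 `def`; `d ≥ 2`, `L ≥ 2`; `V₁, V₂` Lipschitz `(α, β)`, `W` bounded `(α′, β′)`; an admissible fine rate `κ`; `T ≥ 0` with `Tκ₀ ≤ 1∕2`, `Tκ_c ≤ 1∕2`, `4Tκ₀Cst ≤ γ_B`):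
* **`exists_decay_inv_pertCov_QB_coupling`** — `∃ κ′ B′ > 0`: `EntryDecay distK (c_k(t)⁻¹) B′ κ′` for EVERY torus, EVERY such letter, `‖t‖ ≤ T`, `k`.
* **`twoLevelDecayRate_effForm_perturbed_coupling`** — `∃ κ′ > 0, B`: `‖(Σ_{k+1}(t) − Σ_k(t))(x,y)‖ ≤ B(√(L⁻¹))^k e^{−(κ′∕2)distK(x,y)}` for EVERY torus, letter, `‖t‖ ≤ T`, regulator `a″`.
WHAT IT DOES NOT DO: the volume limit and the END (PART 249); base couplings outside the disc.  SUPPLIER work; NEVER «G-an2-4 closed»; NOT (CONV-C), NOT D1, NOT `BetaPertH`, NOT continuum, NOT Clay.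
Records: `HOME/b2b-balaban-gan24-p3/gen65/README.md`.
-/

noncomputable section

open scoped BigOperators ComplexConjugate Matrix Matrix.Norms.L2Operator
open Filter Topology

namespace Summit.QuantumFields.BalabanUV.Beta.GAN24.CouplingEffectiveFormDecay

open Literature.MathematicalPhysics.QuantumFieldTheory.Balaban1983to89.B5Prop11Plancherel (Cst Cst_nonneg Tor fine)
open Literature.MathematicalPhysics.QuantumFieldTheory.Balaban1983to89.B5Prop11Lower (nsq nsq_nonneg norm_form_le)
open Literature.MathematicalPhysics.QuantumFieldTheory.Balaban1983to89.B5G183RateUnitTower (lev)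
open Summit.QuantumFields.BalabanUV.T4Continuum
open Summit.QuantumFields.BalabanUV.T4Continuum.CoerciveInverseTower (Coercive)
open Summit.QuantumFields.BalabanUV.T4Continuum.CovariantAveragingTower (avgTow)
open Summit.QuantumFields.BalabanUV.T4Continuum.BalabanAveragedTowerUnit (idx QBlev calGlev unitCovB one_le_lev' opNorm_QBlev_sq_le norm_entry_le_opNorm)
open Summit.QuantumFields.BalabanUV.T4Continuum.BalabanAveragedCoercive (gammaB gammaB_pos)
open Summit.QuantumFields.BalabanUV.T4Continuum.BalabanAveragedCoerciveTower (uniformCoercive_unitCovB)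
open Summit.QuantumFields.BalabanUV.T4Continuum.BalabanLineAverage (CQB)
open Summit.QuantumFields.BalabanUV.T4Continuum.BackgroundResolventTower (PerturbationLaws Cpert opNorm_avgTow_perturbed_sub_le)
open Summit.QuantumFields.BalabanUV.T4Continuum.KingPairingPlantedLaw (JpcT calDalev calDalev_inv CJ CJ_nonneg isUnit_det_calDalev opNorm_inv_calDalev_le)
open Summit.QuantumFields.BalabanUV.T4Continuum.FirstOrderBackgroundModel (LipschitzBackground Pmodel C2model)
open Summit.QuantumFields.BalabanUV.T4Continuum.FirstOrderAdjointModel (C2adj C2adj_nonneg)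
open Summit.QuantumFields.BalabanUV.T4Continuum.PerturbationAlgebra (BoundedBackground)
open Summit.QuantumFields.BalabanUV.T4Continuum.CTWeightedCoercivity (conjMat conjMat_apply ConjDefect WCoercive conjDefect_of_opNorm wCoercive_of_coercive)
open Summit.QuantumFields.BalabanUV.T4Continuum.CTAveragedTowerDecay (opNorm_conjMat_inv_le_of_wCoercive opNorm_conjMat_pertInv_le_of_wCoercive)
open Summit.QuantumFields.BalabanUV.T4Continuum.CovariantBlockAveraging (opNorm_le_sqrt_of_schur)
open Summit.QuantumFields.BalabanUV.T4Continuum.CTKingTowerWeights (rho distK distK_comm)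
open Summit.QuantumFields.BalabanUV.T4Continuum.CTConjugatedHbd (G2 G2_nonneg wCoercive_calDa_of_conjDefect)
open Summit.QuantumFields.BalabanUV.T4Continuum.CTConjDefectDischarge (conjDefect_calDalev_rho max_JA_lt_gamD)
open Summit.QuantumFields.BalabanUV.T4Continuum.CTAdmissibleRate (exists_pos_le_one_of_eventually)
open Summit.QuantumFields.BalabanUV.T4Continuum.DirichletRegionTower (gamD gamD_pos)
open Summit.QuantumFields.BalabanUV.T4Continuum.ScalarAveragedPropagator (gammaPs)
open Summit.QuantumFields.BalabanUV.T4Continuum.ScalarAveragedCompression (sigma0)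
open Summit.QuantumFields.BalabanUV.T4Continuum.CTScalarGreen (Jfree)
open Summit.QuantumFields.BalabanUV.T4Continuum.CTGaugeTerm (deltaK)
open Summit.QuantumFields.BalabanUV.T4Continuum.CTVectorPropagator (JA)
open Summit.QuantumFields.BalabanUV.T4Continuum.DecayRateInterpolation (EntryDecay DecayRate TwoLevelDecayRate decayStations_of_rate)
open Summit.QuantumFields.BalabanUV.Beta.GAN24.CouplingLetterStencil (perturbationLaws_couplingLetter hPc_couplingLetter)
open Summit.QuantumFields.BalabanUV.Beta.GAN24.EffectiveFormDecayBackground (entryDecay_inv_distK_re hdecB_pert_of_wCoercive coercive_mono coercive_pertCov_QB Cpert_le_of_norm_le)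
open Summit.QuantumFields.BalabanUV.Beta.GAN24.InsertionChainDecayBalaban (hdecB_of_conjBound)
open Summit.QuantumFields.BalabanUV.Beta.GAN24.UnitLatticeDecayAlgebra (abs_dist_sub_dist_le distK_nonneg distK_self distK_triangle sum_exp_distK_le)
open Summit.QuantumFields.BalabanUV.Beta.GAN24.EffectiveFormInsertionLaw (effForm_perturbed_balaban)
open Summit.QuantumFields.BalabanUV.Beta.GAN24.EffectiveFormDecay (entryDecay_of_le_rate)

variable {d : ℕ} (L : ℕ) [NeZero L] (a : ℝ) (ha : 0 < a)

/-- **`exists_decay_inv_pertCov_QB` — THE PERTURBED BLOCK PROPAGATOR's INVERSE DECAYS, UNIFORMLY IN LEVEL, VOLUME AND COUPLING DISC** [our proof] (`d ≥ 2`; first-order model; an admissible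
fine rate `κ`; `κ_c = d·α·G2(…)`, `κ₀ = d(α+β)Cst`; `T ≥ 0` with `T·κ₀ ≤ 1∕2`, `T·κ_c ≤ 1∕2`, `4T·κ₀·Cst ≤ γ_B`): `∃ κ′ B′ > 0` with `EntryDecay distK (c_k(t)⁻¹) B′ κ′` for EVERY `M`, `V`, `‖t‖ ≤ T`, `k`. -/
theorem exists_decay_inv_pertCov_QB_coupling (hd : 2 ≤ d) {α β α' β' a' κ : ℝ} (hαβ : 0 ≤ α ∧ 0 ≤ β) (hαβ' : 0 ≤ α' ∧ 0 ≤ β') (ha' : 0 < a') (hκ0 : 0 < κ)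
    (hγ' : Jfree d a' κ 1 < gammaPs d a') (hδ' : deltaK d a' κ 1 < sigma0 d a' ^ 2) (hJA : JA d a a' κ 1 < gamD d a) {T : ℝ} (hT0 : 0 ≤ T)
    (hT₁ : T * (2 * (d * (α + β) * Cst d a) + α' * Cst d a) ≤ 1 / 2)
    (hT₂ : T * (d * (α * G2 d a (max (JA d a a' κ 1) 0) (gamD d a - max (JA d a a' κ 1) 0) κ)
      + d * (Real.exp |κ| * (α * G2 d a (max (JA d a a' κ 1) 0) (gamD d a - max (JA d a a' κ 1) 0) κ + β * (gamD d a - max (JA d a a' κ 1) 0)⁻¹))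
      + α' * (gamD d a - max (JA d a a' κ 1) 0)⁻¹) ≤ 1 / 2)
    (hT₃ : 4 * T * (2 * (d * (α + β) * Cst d a) + α' * Cst d a) * Cst d a ≤ gammaB d a) :
    ∃ κ' B' : ℝ, 0 < κ' ∧ 0 < B' ∧ ∀ (M : Fin d → ℕ) [∀ μ, NeZero (M μ)] (V₁ V₂ : (k : ℕ) → Fin d → (idx L M k → ℂ)) (W : (k : ℕ) → (idx L M k → ℂ))
      (_hV₁ : LipschitzBackground L M V₁ α β) (_hV₂ : LipschitzBackground L M V₂ α β) (_hW : BoundedBackground L M W α' β') (t : ℂ) (_ht : ‖t‖ ≤ T) (k : ℕ),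
      EntryDecay (distK L M) (avgTow (QBlev L M) ((L : ℝ) ^ d) (fun k => (calDalev L M a ha k + t • (Pmodel L M V₁ k + (Pmodel L M V₂ k)ᴴ + Matrix.diagonal (W k)))⁻¹) k)⁻¹ B' κ' := by
  set J : ℝ := max (JA d a a' κ 1) 0 with hJdef
  have hJ0 : 0 ≤ J := le_max_right _ _
  have hJγ : J < gamD d a := max_JA_lt_gamD a hJA
  set κc : ℝ := d * (α * G2 d a J (gamD d a - J) κ) + d * (Real.exp |κ| * (α * G2 d a J (gamD d a - J) κ + β * (gamD d a - J)⁻¹)) + α' * (gamD d a - J)⁻¹ with hκc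
  set κ₀ : ℝ := 2 * (d * (α + β) * Cst d a) + α' * Cst d a with hκ₀
  have hκ₀0 : 0 ≤ κ₀ := by have := Cst_nonneg d a; have := hαβ.1; have := hαβ.2; have := hαβ'.1; positivity
  have hκc0 : 0 ≤ κc := by
    have := G2_nonneg (d := d) a J (sub_pos.mpr hJγ) κ; have := hαβ.1; have := hαβ.2; have := hαβ'.1
    have : 0 ≤ (gamD d a - J)⁻¹ := inv_nonneg.mpr (sub_pos.mpr hJγ).le
    positivity
  have hγB : 0 < gammaB d a := gammaB_pos a ha
  -- the `hdec` constant on the disc: `(γ_D − J)⁻¹ · 2 · e^{4κ}`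
  set Bc : ℝ := (gamD d a - J)⁻¹ * 2 * Real.exp (κ * 4) with hBc
  have hBc0 : 0 ≤ Bc := by have := sub_pos.mpr hJγ; positivity
  -- the accretive step at reference rate `κ/2`
  obtain ⟨S, hS0, hS⟩ := entryDecay_inv_distK_re (d := d) hd (half_lt_self hκ0)
  set c : ℝ := (κ - κ / 2) / 2 with hcdef
  have hc0 : 0 < c := by rw [hcdef]; linarith
  -- choose `κ′ ∈ (0, κ/2]` with `κ′·Bc·dS/c < γ_B/2` (continuity at 0)
  have hev : ∀ᶠ κ' : ℝ in 𝓝 0, κ' * Bc * (d * S) / c < gammaB d a / 2 ∧ κ' ≤ κ / 2 := by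
    refine Filter.Eventually.and ?_ (eventually_le_nhds (half_pos hκ0))
    have hcont : Continuous fun κ' : ℝ => κ' * Bc * (d * S) / c := by fun_prop
    have h0 : (fun κ' : ℝ => κ' * Bc * (d * S) / c) 0 < gammaB d a / 2 := by simp [half_pos hγB]
    exact hcont.continuousAt.eventually_lt continuousAt_const h0
  obtain ⟨κ', hκ'0, -, hlt, hle⟩ := exists_pos_le_one_of_eventually hev
  refine ⟨κ', (gammaB d a / 2 - κ' * Bc * (d * S) / c)⁻¹, hκ'0, inv_pos.mpr (sub_pos.mpr hlt), fun M _ V₁ V₂ W hV₁ hV₂ hW t ht k => ?_⟩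
  have hWc : ∀ (k : ℕ) (y : idx L M 0), WCoercive (calDalev L M a ha k) κ (rho L M k y) (gamD d a - J) :=
    fun k y => wCoercive_calDa_of_conjDefect (lev L k) (one_le_lev' L k) M a ha (conjDefect_calDalev_rho L M a ha ha' hγ' hδ' k y)
  have hPc : ∀ (k : ℕ) (y : idx L M 0),
      ‖conjMat κ (rho L M k y) (rho L M k y) ((Pmodel L M V₁ k + (Pmodel L M V₂ k)ᴴ + Matrix.diagonal (W k))) * conjMat κ (rho L M k y) (rho L M k y) (calDalev L M a ha k)⁻¹‖ ≤ κc :=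
    fun k y => hPc_couplingLetter L M a ha hV₁ hV₂ hW hJ0 hJγ k y (conjDefect_calDalev_rho L M a ha ha' hγ' hδ' k y)
  have htc : ‖t‖ * κc < 1 := by have := mul_le_mul_of_nonneg_right ht hκc0; linarith
  have ht₀ : ‖t‖ * κ₀ < 1 := by have := mul_le_mul_of_nonneg_right ht hκ₀0; linarith
  have hdec0 := hdecB_pert_of_wCoercive L M a ha (P := fun k => (Pmodel L M V₁ k + (Pmodel L M V₂ k)ᴴ + Matrix.diagonal (W k))) hκ0.le (sub_pos.mpr hJγ) hWc hPc htc k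
  have hνc : (1 - ‖t‖ * κc)⁻¹ ≤ 2 := by
    have h1 : (1 : ℝ) / 2 ≤ 1 - ‖t‖ * κc := by have := mul_le_mul_of_nonneg_right ht hκc0; linarith
    have := inv_anti₀ (by norm_num : (0 : ℝ) < 1 / 2) h1
    rwa [one_div, inv_inv] at this
  have hdec : EntryDecay (distK L M) (avgTow (QBlev L M) ((L : ℝ) ^ d) (fun k => (calDalev L M a ha k + t • (Pmodel L M V₁ k + (Pmodel L M V₂ k)ᴴ + Matrix.diagonal (W k)))⁻¹) k) Bc κ := by
    refine hdec0.mono ?_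
    rw [hBc]
    have h1 : 0 ≤ (gamD d a - J)⁻¹ := inv_nonneg.mpr (sub_pos.mpr hJγ).le
    gcongr
  have hco0 := coercive_pertCov_QB L M a ha (perturbationLaws_couplingLetter L M a ha (le_trans one_le_two hd) hV₁ hV₂ hW) ht₀ k
  have hco : Coercive (gammaB d a / 2) (avgTow (QBlev L M) ((L : ℝ) ^ d) (fun k => (calDalev L M a ha k + t • (Pmodel L M V₁ k + (Pmodel L M V₂ k)ᴴ + Matrix.diagonal (W k)))⁻¹) k) := by
    refine coercive_mono hco0 ?_
    have hν : (1 - ‖t‖ * κ₀)⁻¹ ≤ 2 := by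
      have h1 : (1 : ℝ) / 2 ≤ 1 - ‖t‖ * κ₀ := by have := mul_le_mul_of_nonneg_right ht hκ₀0; linarith
      have := inv_anti₀ (by norm_num : (0 : ℝ) < 1 / 2) h1
      rwa [one_div, inv_inv] at this
    have hν0 : 0 ≤ (1 - ‖t‖ * κ₀)⁻¹ := inv_nonneg.mpr (by linarith)
    have hCst := Cst_nonneg d a
    have h2 : ‖t‖ * κ₀ * Cst d a * (1 - ‖t‖ * κ₀)⁻¹ ≤ T * κ₀ * Cst d a * 2 :=
      mul_le_mul (mul_le_mul_of_nonneg_right (mul_le_mul_of_nonneg_right ht hκ₀0) hCst) hν hν0 (by positivity)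
    rw [hκ₀] at h2 hT₃
    linarith
  exact hS L M _ (gammaB d a / 2) Bc κ' hco hdec hBc0 hκ'0.le hle hlt

/-- **`twoLevelDecayRate_effForm_perturbed` — ROUTE R6's END WITH (PERTURBATIVE) BACKGROUND IN BOTH CURRENCIES, UNCONDITIONALLY** [our proof] (`L ≥ 2`, `d ≥ 2`; hypotheses as above):
`∃ κ′ > 0, B` such that for EVERY torus `M`, background `V`, coupling `‖t‖ ≤ T` and regulator `a″`, `Σ_k(t) = c_k(t)⁻¹ − a″·1` obeys `‖(Σ_{k+1}(t) − Σ_k(t))(x,y)‖ ≤ B·(√(L⁻¹))^k·e^{−(κ′∕2)·distK(x,y)}`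
— NO (STAB)^{cov} ∕ (CONS) ∕ `τ_j` ∕ UB ∕ `hdec` letter (rate: PART 118's `effForm_perturbed_balaban` at `θ = 1∕2`, `Cpert(t)` made constant on the disc; decay: §3; join: `decayStations_of_rate`).
[cite: King1986, Lemma 4.5 (4.38) p.674 (shape)] -/
theorem twoLevelDecayRate_effForm_perturbed_coupling (hL : 2 ≤ L) (hd : 2 ≤ d) {α β α' β' a' κ : ℝ} (hαβ : 0 ≤ α ∧ 0 ≤ β) (hαβ' : 0 ≤ α' ∧ 0 ≤ β') (ha' : 0 < a') (hκ0 : 0 < κ)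
    (hγ' : Jfree d a' κ 1 < gammaPs d a') (hδ' : deltaK d a' κ 1 < sigma0 d a' ^ 2) (hJA : JA d a a' κ 1 < gamD d a) {T : ℝ} (hT0 : 0 ≤ T)
    (hT₁ : T * (2 * (d * (α + β) * Cst d a) + α' * Cst d a) ≤ 1 / 2)
    (hT₂ : T * (d * (α * G2 d a (max (JA d a a' κ 1) 0) (gamD d a - max (JA d a a' κ 1) 0) κ)
      + d * (Real.exp |κ| * (α * G2 d a (max (JA d a a' κ 1) 0) (gamD d a - max (JA d a a' κ 1) 0) κ + β * (gamD d a - max (JA d a a' κ 1) 0)⁻¹))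
      + α' * (gamD d a - max (JA d a a' κ 1) 0)⁻¹) ≤ 1 / 2)
    (hT₃ : 4 * T * (2 * (d * (α + β) * Cst d a) + α' * Cst d a) * Cst d a ≤ gammaB d a) :
    ∃ κ' B : ℝ, 0 < κ' ∧ ∀ (M : Fin d → ℕ) [∀ μ, NeZero (M μ)] (V₁ V₂ : (k : ℕ) → Fin d → (idx L M k → ℂ)) (W : (k : ℕ) → (idx L M k → ℂ))
      (_hV₁ : LipschitzBackground L M V₁ α β) (_hV₂ : LipschitzBackground L M V₂ α β) (_hW : BoundedBackground L M W α' β') (t : ℂ) (_ht : ‖t‖ ≤ T) (a'' : ℂ),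
      TwoLevelDecayRate (distK L M)
        (fun k => (avgTow (QBlev L M) ((L : ℝ) ^ d) (fun k => (calDalev L M a ha k + t • (Pmodel L M V₁ k + (Pmodel L M V₂ k)ᴴ + Matrix.diagonal (W k)))⁻¹) k)⁻¹
          - a'' • (1 : Matrix (idx L M 0) (idx L M 0) ℂ))
        B (κ' / 2) (Real.sqrt ((L : ℝ)⁻¹)) := by
  obtain ⟨κ', B', hκ', hB', hdec⟩ := exists_decay_inv_pertCov_QB_coupling L a ha hd hαβ hαβ' ha' hκ0 hγ' hδ' hJA hT0 hT₁ hT₂ hT₃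
  have hd1 : 1 ≤ d := le_trans one_le_two hd
  set κ₀ : ℝ := 2 * (d * (α + β) * Cst d a) + α' * Cst d a with hκ₀
  have hκ₀0 : 0 ≤ κ₀ := by have := Cst_nonneg d a; have := hαβ.1; have := hαβ.2; have := hαβ'.1; positivity
  have hC2 : 0 ≤ C2model d L a α β + C2adj d L a α β + Cst d a * β' * Cst d a := by
    have h1 : 0 ≤ C2model d L a α β := by unfold C2model; have := Cst_nonneg d a; have := hαβ.1; have := hαβ.2; positivity
    have h2 := C2adj_nonneg d L a hαβ.1 hαβ.2
    have := Cst_nonneg d a; have := hαβ'.2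
    positivity
  -- the uniform rate constant on the disc
  set Cmax : ℝ := ((gammaB d a)⁻¹ * (1 - 1 / 2)⁻¹) ^ 2 * (4 * (CJ d a + T * (C2model d L a α β + C2adj d L a α β + Cst d a * β' * Cst d a)) + 2 * (2 * d * Cst d a + 2 * (d * L * Cst d a)))
    with hCmax
  refine ⟨κ', Real.sqrt (2 * B' * (2 * Cmax / (1 - (L : ℝ)⁻¹))), hκ', fun M _ V₁ V₂ W hV₁ hV₂ hW t ht a'' => ?_⟩
  have hL1 : (1 : ℝ) < L := by exact_mod_cast (lt_of_lt_of_le one_lt_two hL : 1 < L)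
  have hρ0 : (0 : ℝ) ≤ (L : ℝ)⁻¹ := inv_nonneg.mpr (Nat.cast_nonneg _)
  have hρ1 : ((L : ℝ)⁻¹) < 1 := inv_lt_one_of_one_lt₀ hL1
  have hpert := perturbationLaws_couplingLetter L M a ha hd1 hV₁ hV₂ hW
  have ht₀ : ‖t‖ * κ₀ < 1 := by have := mul_le_mul_of_nonneg_right ht hκ₀0; linarith
  -- PART 118's Neumann smallness at `θ = 1/2`
  have hθ : (gammaB d a)⁻¹ * (‖t‖ * κ₀ * Cst d a * (1 - ‖t‖ * κ₀)⁻¹) ≤ 1 / 2 := by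
    have hγB : 0 < gammaB d a := gammaB_pos a ha
    have hν : (1 - ‖t‖ * κ₀)⁻¹ ≤ 2 := by
      have h1 : (1 : ℝ) / 2 ≤ 1 - ‖t‖ * κ₀ := by have := mul_le_mul_of_nonneg_right ht hκ₀0; linarith
      have := inv_anti₀ (by norm_num : (0 : ℝ) < 1 / 2) h1
      rwa [one_div, inv_inv] at this
    have hν0 : 0 ≤ (1 - ‖t‖ * κ₀)⁻¹ := inv_nonneg.mpr (by linarith)
    have hCst := Cst_nonneg d a
    have hT0' : 0 ≤ T := hT0
    have h2 : ‖t‖ * κ₀ * Cst d a * (1 - ‖t‖ * κ₀)⁻¹ ≤ T * κ₀ * Cst d a * 2 :=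
      mul_le_mul (mul_le_mul_of_nonneg_right (mul_le_mul_of_nonneg_right ht hκ₀0) hCst) hν hν0 (by positivity)
    have h3 : T * κ₀ * Cst d a * 2 ≤ gammaB d a / 2 := by linarith
    rw [inv_mul_le_iff₀ hγB]
    linarith
  obtain ⟨Slim, hlim, hrate⟩ := effForm_perturbed_balaban L M a ha hL hpert ht₀ hθ (by norm_num) 0
  simp only [zero_smul, sub_zero] at hlim hrate
  -- the rate constant made uniform on the disc
  have hCp : Cpert κ₀ (2 * d * Cst d a) (CJ d a) ((C2model d L a α β + C2adj d L a α β + Cst d a * β' * Cst d a)) (d * L * Cst d a) t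
      ≤ 4 * (CJ d a + T * (C2model d L a α β + C2adj d L a α β + Cst d a * β' * Cst d a)) + 2 * (2 * d * Cst d a + 2 * (d * L * Cst d a)) :=
    Cpert_le_of_norm_le hκ₀0 (by have := Cst_nonneg d a; positivity) (CJ_nonneg d a) hC2 (by have := Cst_nonneg d a; positivity) ht
      (by rw [hκ₀]; exact hT₁)
  have hrate' : ∀ k, ‖(avgTow (QBlev L M) ((L : ℝ) ^ d) (fun k => (calDalev L M a ha k + t • (Pmodel L M V₁ k + (Pmodel L M V₂ k)ᴴ + Matrix.diagonal (W k)))⁻¹) k)⁻¹ - Slim‖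
      ≤ Cmax * ((L : ℝ)⁻¹) ^ k / (1 - (L : ℝ)⁻¹) := by
    intro k
    refine (hrate k).trans ?_
    have h1ρ : 0 < 1 - (L : ℝ)⁻¹ := sub_pos.mpr hρ1
    rw [hCmax]
    exact div_le_div_of_nonneg_right (mul_le_mul_of_nonneg_right (mul_le_mul_of_nonneg_left hCp (sq_nonneg _)) (pow_nonneg hρ0 k)) h1ρ.le
  -- the two-level shape for `c_k(t)⁻¹`; the regulator cancels in the differences of `Σ_k(t) = c_k(t)⁻¹ − a″·1`
  have h3 := (decayStations_of_rate hρ0 hρ1 hlim hrate' (fun k => hdec M V₁ V₂ W hV₁ hV₂ hW t ht k)).2.2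
  intro k x y
  have e : ((avgTow (QBlev L M) ((L : ℝ) ^ d) (fun k => (calDalev L M a ha k + t • (Pmodel L M V₁ k + (Pmodel L M V₂ k)ᴴ + Matrix.diagonal (W k)))⁻¹) (k + 1))⁻¹
        - a'' • (1 : Matrix (idx L M 0) (idx L M 0) ℂ))
      - ((avgTow (QBlev L M) ((L : ℝ) ^ d) (fun k => (calDalev L M a ha k + t • (Pmodel L M V₁ k + (Pmodel L M V₂ k)ᴴ + Matrix.diagonal (W k)))⁻¹) k)⁻¹
        - a'' • (1 : Matrix (idx L M 0) (idx L M 0) ℂ))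
      = (avgTow (QBlev L M) ((L : ℝ) ^ d) (fun k => (calDalev L M a ha k + t • (Pmodel L M V₁ k + (Pmodel L M V₂ k)ᴴ + Matrix.diagonal (W k)))⁻¹) (k + 1))⁻¹
        - (avgTow (QBlev L M) ((L : ℝ) ^ d) (fun k => (calDalev L M a ha k + t • (Pmodel L M V₁ k + (Pmodel L M V₂ k)ᴴ + Matrix.diagonal (W k)))⁻¹) k)⁻¹ := by abel
  rw [e]
  exact h3 k x y

end Summit.QuantumFields.BalabanUV.Beta.GAN24.CouplingEffectiveFormDecay

end
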